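import Summits.Ventures.PercRepro.S4MidKeyBaseSum

/-!
# PercRepro — THE MIDDLE KEY AT LEVEL `10`: THE BASE — RE-ISSUE (the post-accept olean build of S4MidKeyBaseTen p710415 was dropped on the hub; byte-for-byte the same statements under the names `*_b`, the original stays the module of record — the p2-g29 workaround) (p1, gen 47; an S4 feeder — p9 owns SUBCLAIM-S4; no window claim here)

The level-`10` ingredients of the middle key (see S4MidKeyBase / S4MidKeyBaseEight / S4MidKeyBaseNine for levels `7` / `8` / `9`):
`topCount_le_sum_uSets_ten` (`#U(p, 10) ≤ Σ_{10 ≤ k ≤ 639} #uSets k`: a `U`-set's complement is a rank-`10` set of `10 … 639` points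
on the `e`-free core, `f(10) = 639` — the flat bound is a HYPOTHESIS here, supplied in the row modules by
`ThmN.ncard_le_six_thirty_nine_of_eRk_le_ten_of_free`), its one-row form `topCount_le_sum_rkSets_ten` (`#U(p, 10) ≤ Σ_{10 ≤ k ≤ 639} m[k, 10]`,
as S4MidKeyBaseSum at levels `7` … `9`), and the numerals `phiK_<word>_ten` (`Φ(p, 10)` for `p = 12 … 60`, from `phiK_eq_two_pow_sub`).
Coloops are not excluded. Axioms: standard.
-/

open scoped Matroid

namespace PercRepro

namespace S4Mid

open Set Finset S2LP S3Mid

variable {α : Type} {M : Matroid α} [M.Finite]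

/-- **`#U(p, 10) ≤ Σ_{10 ≤ k ≤ 639} #uSets k`**: the complement of a `U`-set is a rank-`10` set, of `10 … 639` points when every
rank-`10` set has `≤ 639` points. -/
theorem topCount_le_sum_uSets_ten_b (p : ℕ) (h639 : ∀ X ⊆ M.E, M.eRk X ≤ ((10 : ℕ) : ℕ∞) → X.ncard ≤ 639)
    (hn639 : 639 ≤ M.E.ncard) :
    Matroid.topCount M p 10 ≤ ∑ i ∈ Finset.range 630, (uSets M p 10 (10 + i)).ncard := by
  rw [topCount_eq_sum_uSets, ← S3LP.sum_Icc_eq_sum_range (fun k => (uSets M p 10 k).ncard) 10 639]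
  refine le_of_eq (Finset.sum_subset ?_ ?_).symm
  · intro k hk
    simp only [Finset.mem_Icc] at hk
    simp only [Finset.mem_range]
    omega
  · intro k _ hk
    simp only [Finset.mem_Icc, not_and_or, not_le] at hk
    have h1 := ncard_uSets_le_rkSets (M := M) p 10 k
    rcases hk with hk | hk
    · rw [S3LP.z_lt k 10 hk] at h1; omega
    · rw [rkSets_eq_empty_of_flat h639 le_rfl hk, Set.ncard_empty] at h1; omega

/-- **`#U(p, 10) ≤ Σ_{10 ≤ k ≤ 639} m[k, 10]`** on the `e`-free core (the one-row `U`-side of the middle key at level `10`). -/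
theorem topCount_le_sum_rkSets_ten_b (p : ℕ) (h639 : ∀ X ⊆ M.E, M.eRk X ≤ ((10 : ℕ) : ℕ∞) → X.ncard ≤ 639)
    (hn639 : 639 ≤ M.E.ncard) :
    Matroid.topCount M p 10 ≤ ∑ i ∈ Finset.range 630, (S1.rkSets M (10 + i) 10).ncard :=
  (topCount_le_sum_uSets_ten_b p h639 hn639).trans
    (Finset.sum_le_sum fun i _ => ncard_uSets_le_rkSets (M := M) p 10 (10 + i))

/-- `Φ(12, 10) = 12 / 11`. -/
theorem phiK_twelve_ten_b : phiK 12 10 = 12 / 11 := by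
  rw [HypKey.phiK_eq_two_pow_sub 12 10 (by norm_num), Nat.choose_symm_add]
  simp only [Finset.sum_range_succ, Finset.sum_range_zero]
  norm_num [Nat.choose_eq_descFactorial_div_factorial, Nat.descFactorial_succ, Nat.descFactorial_zero, Nat.factorial]

/-- `Φ(13, 10) = 26 / 11`. -/
theorem phiK_thirteen_ten_b : phiK 13 10 = 26 / 11 := by
  rw [HypKey.phiK_eq_two_pow_sub 13 10 (by norm_num), Nat.choose_symm_add]
  simp only [Finset.sum_range_succ, Finset.sum_range_zero]
  norm_num [Nat.choose_eq_descFactorial_div_factorial, Nat.descFactorial_succ, Nat.descFactorial_zero, Nat.factorial]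

/-- `Φ(14, 10) = 259 / 66`. -/
theorem phiK_fourteen_ten_b : phiK 14 10 = 259 / 66 := by
  rw [HypKey.phiK_eq_two_pow_sub 14 10 (by norm_num), Nat.choose_symm_add]
  simp only [Finset.sum_range_succ, Finset.sum_range_zero]
  norm_num [Nat.choose_eq_descFactorial_div_factorial, Nat.descFactorial_succ, Nat.descFactorial_zero, Nat.factorial]

/-- `Φ(15, 10) = 65 / 11`. -/
theorem phiK_fifteen_ten_b : phiK 15 10 = 65 / 11 := by
  rw [HypKey.phiK_eq_two_pow_sub 15 10 (by norm_num), Nat.choose_symm_add]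
  simp only [Finset.sum_range_succ, Finset.sum_range_zero]
  norm_num [Nat.choose_eq_descFactorial_div_factorial, Nat.descFactorial_succ, Nat.descFactorial_zero, Nat.factorial]

/-- `Φ(16, 10) = 1216 / 143`. -/
theorem phiK_sixteen_ten_b : phiK 16 10 = 1216 / 143 := by
  rw [HypKey.phiK_eq_two_pow_sub 16 10 (by norm_num), Nat.choose_symm_add]
  simp only [Finset.sum_range_succ, Finset.sum_range_zero]
  norm_num [Nat.choose_eq_descFactorial_div_factorial, Nat.descFactorial_succ, Nat.descFactorial_zero, Nat.factorial]

/-- `Φ(17, 10) = 5134 / 429`. -/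
theorem phiK_seventeen_ten_b : phiK 17 10 = 5134 / 429 := by
  rw [HypKey.phiK_eq_two_pow_sub 17 10 (by norm_num), Nat.choose_symm_add]
  simp only [Finset.sum_range_succ, Finset.sum_range_zero]
  norm_num [Nat.choose_eq_descFactorial_div_factorial, Nat.descFactorial_succ, Nat.descFactorial_zero, Nat.factorial]

/-- `Φ(18, 10) = 16689 / 1001`. -/
theorem phiK_eighteen_ten_b : phiK 18 10 = 16689 / 1001 := by
  rw [HypKey.phiK_eq_two_pow_sub 18 10 (by norm_num), Nat.choose_symm_add]
  simp only [Finset.sum_range_succ, Finset.sum_range_zero]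
  norm_num [Nat.choose_eq_descFactorial_div_factorial, Nat.descFactorial_succ, Nat.descFactorial_zero, Nat.factorial]

/-- `Φ(19, 10) = 23180 / 1001`. -/
theorem phiK_nineteen_ten_b : phiK 19 10 = 23180 / 1001 := by
  rw [HypKey.phiK_eq_two_pow_sub 19 10 (by norm_num), Nat.choose_symm_add]
  simp only [Finset.sum_range_succ, Finset.sum_range_zero]
  norm_num [Nat.choose_eq_descFactorial_div_factorial, Nat.descFactorial_succ, Nat.descFactorial_zero, Nat.factorial]

/-- `Φ(20, 10) = 96724 / 3003`. -/
theorem phiK_twenty_ten_b : phiK 20 10 = 96724 / 3003 := by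
  rw [HypKey.phiK_eq_two_pow_sub 20 10 (by norm_num), Nat.choose_symm_add]
  simp only [Finset.sum_range_succ, Finset.sum_range_zero]
  norm_num [Nat.choose_eq_descFactorial_div_factorial, Nat.descFactorial_succ, Nat.descFactorial_zero, Nat.factorial]

/-- `Φ(21, 10) = 6434 / 143`. -/
theorem phiK_twentyone_ten_b : phiK 21 10 = 6434 / 143 := by
  rw [HypKey.phiK_eq_two_pow_sub 21 10 (by norm_num), Nat.choose_symm_add]
  simp only [Finset.sum_range_succ, Finset.sum_range_zero]
  norm_num [Nat.choose_eq_descFactorial_div_factorial, Nat.descFactorial_succ, Nat.descFactorial_zero, Nat.factorial]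

/-- `Φ(22, 10) = 6577 / 104`. -/
theorem phiK_twentytwo_ten_b : phiK 22 10 = 6577 / 104 := by
  rw [HypKey.phiK_eq_two_pow_sub 22 10 (by norm_num), Nat.choose_symm_add]
  simp only [Finset.sum_range_succ, Finset.sum_range_zero]
  norm_num [Nat.choose_eq_descFactorial_div_factorial, Nat.descFactorial_succ, Nat.descFactorial_zero, Nat.factorial]

/-- `Φ(23, 10) = 51221 / 572`. -/
theorem phiK_twentythree_ten_b : phiK 23 10 = 51221 / 572 := by
  rw [HypKey.phiK_eq_two_pow_sub 23 10 (by norm_num), Nat.choose_symm_add]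
  simp only [Finset.sum_range_succ, Finset.sum_range_zero]
  norm_num [Nat.choose_eq_descFactorial_div_factorial, Nat.descFactorial_succ, Nat.descFactorial_zero, Nat.factorial]

/-- `Φ(24, 10) = 310758 / 2431`. -/
theorem phiK_twentyfour_ten_b : phiK 24 10 = 310758 / 2431 := by
  rw [HypKey.phiK_eq_two_pow_sub 24 10 (by norm_num), Nat.choose_symm_add]
  simp only [Finset.sum_range_succ, Finset.sum_range_zero]
  norm_num [Nat.choose_eq_descFactorial_div_factorial, Nat.descFactorial_succ, Nat.descFactorial_zero, Nat.factorial]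

/-- `Φ(25, 10) = 3131890 / 17017`. -/
theorem phiK_twentyfive_ten_b : phiK 25 10 = 3131890 / 17017 := by
  rw [HypKey.phiK_eq_two_pow_sub 25 10 (by norm_num), Nat.choose_symm_add]
  simp only [Finset.sum_range_succ, Finset.sum_range_zero]
  norm_num [Nat.choose_eq_descFactorial_div_factorial, Nat.descFactorial_succ, Nat.descFactorial_zero, Nat.factorial]

/-- `Φ(26, 10) = 3148907 / 11781`. -/
theorem phiK_twentysix_ten_b : phiK 26 10 = 3148907 / 11781 := by
  rw [HypKey.phiK_eq_two_pow_sub 26 10 (by norm_num), Nat.choose_symm_add]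
  simp only [Finset.sum_range_succ, Finset.sum_range_zero]
  norm_num [Nat.choose_eq_descFactorial_div_factorial, Nat.descFactorial_succ, Nat.descFactorial_zero, Nat.factorial]

/-- `Φ(27, 10) = 512544 / 1309`. -/
theorem phiK_twentyseven_ten_b : phiK 27 10 = 512544 / 1309 := by
  rw [HypKey.phiK_eq_two_pow_sub 27 10 (by norm_num), Nat.choose_symm_add]
  simp only [Finset.sum_range_succ, Finset.sum_range_zero]
  norm_num [Nat.choose_eq_descFactorial_div_factorial, Nat.descFactorial_succ, Nat.descFactorial_zero, Nat.factorial]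

/-- `Φ(28, 10) = 2055412 / 3553`. -/
theorem phiK_twentyeight_ten_b : phiK 28 10 = 2055412 / 3553 := by
  rw [HypKey.phiK_eq_two_pow_sub 28 10 (by norm_num), Nat.choose_symm_add]
  simp only [Finset.sum_range_succ, Finset.sum_range_zero]
  norm_num [Nat.choose_eq_descFactorial_div_factorial, Nat.descFactorial_succ, Nat.descFactorial_zero, Nat.factorial]

/-- `Φ(29, 10) = 119419970 / 138567`. -/
theorem phiK_twentynine_ten_b : phiK 29 10 = 119419970 / 138567 := by
  rw [HypKey.phiK_eq_two_pow_sub 29 10 (by norm_num), Nat.choose_symm_add]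
  simp only [Finset.sum_range_succ, Finset.sum_range_zero]
  norm_num [Nat.choose_eq_descFactorial_div_factorial, Nat.descFactorial_succ, Nat.descFactorial_zero, Nat.factorial]

/-- `Φ(30, 10) = 119558537 / 92378`. -/
theorem phiK_thirty_ten_b : phiK 30 10 = 119558537 / 92378 := by
  rw [HypKey.phiK_eq_two_pow_sub 30 10 (by norm_num), Nat.choose_symm_add]
  simp only [Finset.sum_range_succ, Finset.sum_range_zero]
  norm_num [Nat.choose_eq_descFactorial_div_factorial, Nat.descFactorial_succ, Nat.descFactorial_zero, Nat.factorial]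

/-- `Φ(31, 10) = 90467765 / 46189`. -/
theorem phiK_thirtyone_ten_b : phiK 31 10 = 90467765 / 46189 := by
  rw [HypKey.phiK_eq_two_pow_sub 31 10 (by norm_num), Nat.choose_symm_add]
  simp only [Finset.sum_range_succ, Finset.sum_range_zero]
  norm_num [Nat.choose_eq_descFactorial_div_factorial, Nat.descFactorial_succ, Nat.descFactorial_zero, Nat.factorial]

/-- `Φ(32, 10) = 965482176 / 323323`. -/
theorem phiK_thirtytwo_ten_b : phiK 32 10 = 965482176 / 323323 := by
  rw [HypKey.phiK_eq_two_pow_sub 32 10 (by norm_num), Nat.choose_symm_add]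
  simp only [Finset.sum_range_succ, Finset.sum_range_zero]
  norm_num [Nat.choose_eq_descFactorial_div_factorial, Nat.descFactorial_succ, Nat.descFactorial_zero, Nat.factorial]

/-- `Φ(33, 10) = 134763558 / 29393`. -/
theorem phiK_thirtythree_ten_b : phiK 33 10 = 134763558 / 29393 := by
  rw [HypKey.phiK_eq_two_pow_sub 33 10 (by norm_num), Nat.choose_symm_add]
  simp only [Finset.sum_range_succ, Finset.sum_range_zero]
  norm_num [Nat.choose_eq_descFactorial_div_factorial, Nat.descFactorial_succ, Nat.descFactorial_zero, Nat.factorial]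

/-- `Φ(34, 10) = 134792951 / 19019`. -/
theorem phiK_thirtyfour_ten_b : phiK 34 10 = 134792951 / 19019 := by
  rw [HypKey.phiK_eq_two_pow_sub 34 10 (by norm_num), Nat.choose_symm_add]
  simp only [Finset.sum_range_succ, Finset.sum_range_zero]
  norm_num [Nat.choose_eq_descFactorial_div_factorial, Nat.descFactorial_succ, Nat.descFactorial_zero, Nat.factorial]

/-- `Φ(35, 10) = 269623940 / 24453`. -/
theorem phiK_thirtyfive_ten_b : phiK 35 10 = 269623940 / 24453 := by
  rw [HypKey.phiK_eq_two_pow_sub 35 10 (by norm_num), Nat.choose_symm_add]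
  simp only [Finset.sum_range_succ, Finset.sum_range_zero]
  norm_num [Nat.choose_eq_descFactorial_div_factorial, Nat.descFactorial_succ, Nat.descFactorial_zero, Nat.factorial]

/-- `Φ(36, 10) = 1078593572 / 62491`. -/
theorem phiK_thirtysix_ten_b : phiK 36 10 = 1078593572 / 62491 := by
  rw [HypKey.phiK_eq_two_pow_sub 36 10 (by norm_num), Nat.choose_symm_add]
  simp only [Finset.sum_range_succ, Finset.sum_range_zero]
  norm_num [Nat.choose_eq_descFactorial_div_factorial, Nat.descFactorial_succ, Nat.descFactorial_zero, Nat.factorial]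

/-- `Φ(37, 10) = 1698309546 / 62491`. -/
theorem phiK_thirtyseven_ten_b : phiK 37 10 = 1698309546 / 62491 := by
  rw [HypKey.phiK_eq_two_pow_sub 37 10 (by norm_num), Nat.choose_symm_add]
  simp only [Finset.sum_range_succ, Finset.sum_range_zero]
  norm_num [Nat.choose_eq_descFactorial_div_factorial, Nat.descFactorial_succ, Nat.descFactorial_zero, Nat.factorial]

/-- `Φ(38, 10) = 1698372037 / 39468`. -/
theorem phiK_thirtyeight_ten_b : phiK 38 10 = 1698372037 / 39468 := by
  rw [HypKey.phiK_eq_two_pow_sub 38 10 (by norm_num), Nat.choose_symm_add]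
  simp only [Finset.sum_range_succ, Finset.sum_range_zero]
  norm_num [Nat.choose_eq_descFactorial_div_factorial, Nat.descFactorial_succ, Nat.descFactorial_zero, Nat.factorial]

/-- `Φ(39, 10) = 242630215 / 3542`. -/
theorem phiK_thirtynine_ten_b : phiK 39 10 = 242630215 / 3542 := by
  rw [HypKey.phiK_eq_two_pow_sub 39 10 (by norm_num), Nat.choose_symm_add]
  simp only [Finset.sum_range_succ, Finset.sum_range_zero]
  norm_num [Nat.choose_eq_descFactorial_div_factorial, Nat.descFactorial_succ, Nat.descFactorial_zero, Nat.factorial]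

/-- `Φ(40, 10) = 970535028 / 8855`. -/
theorem phiK_forty_ten_b : phiK 40 10 = 970535028 / 8855 := by
  rw [HypKey.phiK_eq_two_pow_sub 40 10 (by norm_num), Nat.choose_symm_add]
  simp only [Finset.sum_range_succ, Finset.sum_range_zero]
  norm_num [Nat.choose_eq_descFactorial_div_factorial, Nat.descFactorial_succ, Nat.descFactorial_zero, Nat.factorial]

/-- `Φ(41, 10) = 79584598406 / 451605`. -/
theorem phiK_fortyone_ten_b : phiK 41 10 = 79584598406 / 451605 := by
  rw [HypKey.phiK_eq_two_pow_sub 41 10 (by norm_num), Nat.choose_symm_add]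
  simp only [Finset.sum_range_succ, Finset.sum_range_zero]
  norm_num [Nat.choose_eq_descFactorial_div_factorial, Nat.descFactorial_succ, Nat.descFactorial_zero, Nat.factorial]

/-- `Φ(42, 10) = 79585050011 / 279565`. -/
theorem phiK_fortytwo_ten_b : phiK 42 10 = 79585050011 / 279565 := by
  rw [HypKey.phiK_eq_two_pow_sub 42 10 (by norm_num), Nat.choose_symm_add]
  simp only [Finset.sum_range_succ, Finset.sum_range_zero]
  norm_num [Nat.choose_eq_descFactorial_div_factorial, Nat.descFactorial_succ, Nat.descFactorial_zero, Nat.factorial]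

/-- `Φ(43, 10) = 129138459312 / 279565`. -/
theorem phiK_fortythree_ten_b : phiK 43 10 = 129138459312 / 279565 := by
  rw [HypKey.phiK_eq_two_pow_sub 43 10 (by norm_num), Nat.choose_symm_add]
  simp only [Finset.sum_range_succ, Finset.sum_range_zero]
  norm_num [Nat.choose_eq_descFactorial_div_factorial, Nat.descFactorial_succ, Nat.descFactorial_zero, Nat.factorial]

/-- `Φ(44, 10) = 516554955508 / 686205`. -/
theorem phiK_fortyfour_ten_b : phiK 44 10 = 516554955508 / 686205 := by
  rw [HypKey.phiK_eq_two_pow_sub 44 10 (by norm_num), Nat.choose_symm_add]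
  simp only [Finset.sum_range_succ, Finset.sum_range_zero]
  norm_num [Nat.choose_eq_descFactorial_div_factorial, Nat.descFactorial_succ, Nat.descFactorial_zero, Nat.factorial]

/-- `Φ(45, 10) = 1033111283426 / 838695`. -/
theorem phiK_fortyfive_ten_b : phiK 45 10 = 1033111283426 / 838695 := by
  rw [HypKey.phiK_eq_two_pow_sub 45 10 (by norm_num), Nat.choose_symm_add]
  simp only [Finset.sum_range_succ, Finset.sum_range_zero]
  norm_num [Nat.choose_eq_descFactorial_div_factorial, Nat.descFactorial_succ, Nat.descFactorial_zero, Nat.factorial]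

/-- `Φ(46, 10) = 1033112122121 / 510510`. -/
theorem phiK_fortysix_ten_b : phiK 46 10 = 1033112122121 / 510510 := by
  rw [HypKey.phiK_eq_two_pow_sub 46 10 (by norm_num), Nat.choose_symm_add]
  simp only [Finset.sum_range_succ, Finset.sum_range_zero]
  norm_num [Nat.choose_eq_descFactorial_div_factorial, Nat.descFactorial_succ, Nat.descFactorial_zero, Nat.factorial]

/-- `Φ(47, 10) = 48556293733657 / 14549535`. -/
theorem phiK_fortyseven_ten_b : phiK 47 10 = 48556293733657 / 14549535 := by
  rw [HypKey.phiK_eq_two_pow_sub 47 10 (by norm_num), Nat.choose_symm_add]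
  simp only [Finset.sum_range_succ, Finset.sum_range_zero]
  norm_num [Nat.choose_eq_descFactorial_div_factorial, Nat.descFactorial_succ, Nat.descFactorial_zero, Nat.factorial]

/-- `Φ(48, 10) = 776900932531072 / 140645505`. -/
theorem phiK_fortyeight_ten_b : phiK 48 10 = 776900932531072 / 140645505 := by
  rw [HypKey.phiK_eq_two_pow_sub 48 10 (by norm_num), Nat.choose_symm_add]
  simp only [Finset.sum_range_succ, Finset.sum_range_zero]
  norm_num [Nat.choose_eq_descFactorial_div_factorial, Nat.descFactorial_succ, Nat.descFactorial_zero, Nat.factorial]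

/-- `Φ(49, 10) = 184349407194442 / 20092215`. -/
theorem phiK_fortynine_ten_b : phiK 49 10 = 184349407194442 / 20092215 := by
  rw [HypKey.phiK_eq_two_pow_sub 49 10 (by norm_num), Nat.choose_symm_add]
  simp only [Finset.sum_range_succ, Finset.sum_range_zero]
  norm_num [Nat.choose_eq_descFactorial_div_factorial, Nat.descFactorial_succ, Nat.descFactorial_zero, Nat.factorial]

/-- `Φ(50, 10) = 184349427286657 / 12055329`. -/
theorem phiK_fifty_ten_b : phiK 50 10 = 184349427286657 / 12055329 := by
  rw [HypKey.phiK_eq_two_pow_sub 50 10 (by norm_num), Nat.choose_symm_add]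
  simp only [Finset.sum_range_succ, Finset.sum_range_zero]
  norm_num [Nat.choose_eq_descFactorial_div_factorial, Nat.descFactorial_succ, Nat.descFactorial_zero, Nat.factorial]

/-- `Φ(51, 10) = 6044243912852 / 236379`. -/
theorem phiK_fiftyone_ten_b : phiK 51 10 = 6044243912852 / 236379 := by
  rw [HypKey.phiK_eq_two_pow_sub 51 10 (by norm_num), Nat.choose_symm_add]
  simp only [Finset.sum_range_succ, Finset.sum_range_zero]
  norm_num [Nat.choose_eq_descFactorial_div_factorial, Nat.descFactorial_succ, Nat.descFactorial_zero, Nat.factorial]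

/-- `Φ(52, 10) = 24176976596924 / 563673`. -/
theorem phiK_fiftytwo_ten_b : phiK 52 10 = 24176976596924 / 563673 := by
  rw [HypKey.phiK_eq_two_pow_sub 52 10 (by norm_num), Nat.choose_symm_add]
  simp only [Finset.sum_range_succ, Finset.sum_range_zero]
  norm_num [Nat.choose_eq_descFactorial_div_factorial, Nat.descFactorial_succ, Nat.descFactorial_zero, Nat.factorial]

/-- `Φ(53, 10) = 2562759579023282 / 35511399`. -/
theorem phiK_fiftythree_ten_b : phiK 53 10 = 2562759579023282 / 35511399 := by
  rw [HypKey.phiK_eq_two_pow_sub 53 10 (by norm_num), Nat.choose_symm_add]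
  simp only [Finset.sum_range_succ, Finset.sum_range_zero]
  norm_num [Nat.choose_eq_descFactorial_div_factorial, Nat.descFactorial_succ, Nat.descFactorial_zero, Nat.factorial]

/-- `Φ(54, 10) = 2562759614534681 / 21043792`. -/
theorem phiK_fiftyfour_ten_b : phiK 54 10 = 2562759614534681 / 21043792 := by
  rw [HypKey.phiK_eq_two_pow_sub 54 10 (by norm_num), Nat.choose_symm_add]
  simp only [Finset.sum_range_succ, Finset.sum_range_zero]
  norm_num [Nat.choose_eq_descFactorial_div_factorial, Nat.descFactorial_succ, Nat.descFactorial_zero, Nat.factorial]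

/-- `Φ(55, 10) = 2562759635578473 / 12434968`. -/
theorem phiK_fiftyfive_ten_b : phiK 55 10 = 2562759635578473 / 12434968 := by
  rw [HypKey.phiK_eq_two_pow_sub 55 10 (by norm_num), Nat.choose_symm_add]
  simp only [Finset.sum_range_succ, Finset.sum_range_zero]
  norm_num [Nat.choose_eq_descFactorial_div_factorial, Nat.descFactorial_succ, Nat.descFactorial_zero, Nat.factorial]

/-- `Φ(56, 10) = 2562759648013441 / 7327749`. -/
theorem phiK_fiftysix_ten_b : phiK 56 10 = 2562759648013441 / 7327749 := by
  rw [HypKey.phiK_eq_two_pow_sub 56 10 (by norm_num), Nat.choose_symm_add]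
  simp only [Finset.sum_range_succ, Finset.sum_range_zero]
  norm_num [Nat.choose_eq_descFactorial_div_factorial, Nat.descFactorial_succ, Nat.descFactorial_zero, Nat.factorial]

/-- `Φ(57, 10) = 76500288219140 / 128557`. -/
theorem phiK_fiftyseven_ten_b : phiK 57 10 = 76500288219140 / 128557 := by
  rw [HypKey.phiK_eq_two_pow_sub 57 10 (by norm_num), Nat.choose_symm_add]
  simp only [Finset.sum_range_succ, Finset.sum_range_zero]
  norm_num [Nat.choose_eq_descFactorial_div_factorial, Nat.descFactorial_succ, Nat.descFactorial_zero, Nat.factorial]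

/-- `Φ(58, 10) = 76500288347697 / 75361`. -/
theorem phiK_fiftyeight_ten_b : phiK 58 10 = 76500288347697 / 75361 := by
  rw [HypKey.phiK_eq_two_pow_sub 58 10 (by norm_num), Nat.choose_symm_add]
  simp only [Finset.sum_range_succ, Finset.sum_range_zero]
  norm_num [Nat.choose_eq_descFactorial_div_factorial, Nat.descFactorial_succ, Nat.descFactorial_zero, Nat.factorial]

/-- `Φ(59, 10) = 9027034033920844 / 5199909`. -/
theorem phiK_fiftynine_ten_b : phiK 59 10 = 9027034033920844 / 5199909 := by
  rw [HypKey.phiK_eq_two_pow_sub 59 10 (by norm_num), Nat.choose_symm_add]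
  simp only [Finset.sum_range_succ, Finset.sum_range_zero]
  norm_num [Nat.choose_eq_descFactorial_div_factorial, Nat.descFactorial_succ, Nat.descFactorial_zero, Nat.factorial]

/-- `Φ(60, 10) = 36108136156483012 / 12133121`. -/
theorem phiK_sixty_ten_b : phiK 60 10 = 36108136156483012 / 12133121 := by
  rw [HypKey.phiK_eq_two_pow_sub 60 10 (by norm_num), Nat.choose_symm_add]
  simp only [Finset.sum_range_succ, Finset.sum_range_zero]
  norm_num [Nat.choose_eq_descFactorial_div_factorial, Nat.descFactorial_succ, Nat.descFactorial_zero, Nat.factorial]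

end S4Mid

end PercRepro
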